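import Literature.NumberTheory.EllipticCurves.HeegnerPointsOfConductorRationalityProofs
import Literature.NumberTheory.EllipticCurves.HeegnerPointsOfConductorPrimeLevel
import HarnessLib

/-!
# Heegner points of EVERY conductor `n ≥ 1` are rational over `K[n]` (no `gcd(n, N) = 1` needed);
# discharge of `phi_heegnerPointOfConductor_mem_range_map_ringClassField_of_prime_dvd_level`

Topic `NumberTheory/EllipticCurves` (complex multiplication on `X₀(N)`). Theorems only (no
definition, no named fact; net Literature debt `−1`).

The tree's Shimura-reciprocity engine `levelTransport_of_transport_lattice_eq` /
`levelTransport_self_of_apply_formJ_eq` (`HeegnerPointsLevelTransport.lean`) pins the transported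
level lattice `Λ_{Nτ}^σ` down by the sandwich `mem_iff_of_level_relations`, which uses Bezout
`uN + vβ = 1` and therefore the hypothesis `gcd(N, D) = 1`. For the Heegner point `x(q)` of conductor
`q ∥ N` (discriminant `q²d_K`, residue `qβ`) that hypothesis fails. Here the sandwich is replaced by
two explicit computations in the basis `(τ, 1)` of `Λ_τ` which use only the PRIMITIVITY of the Heegner
form `Q = (A, B, C)` together with `N ∣ A` (so `gcd(N, B, C) = 1`):

* `mem_lattice_levelPoint_of_inv_theta_mul_mem` — if `y ∈ Λ_τ` and `θy ∈ NΛ_τ`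
  (`θ = (−β + √D)/2`), then `y ∈ Λ_{Nτ}` (coefficient comparison: `N ∣ mB`, `N ∣ mC` force `N ∣ m`);
* `exists_eq_add_of_mem_lattice_levelPoint` — `Λ_{Nτ} ⊆ NΛ_τ + θ'Λ_τ` (`θ' = (−β − √D)/2`), from a
  three-term Bezout `pN + q(Nk + β) + rC = 1`;
* hence the engine WITHOUT `gcd(N, D) = 1`: `levelTransport_of_transport_lattice_eq_of_primitive`,
  `levelTransport_self_of_apply_formJ_eq_of_primitive` (the four `𝔫`-relations are transported as in
  the tree — `IsTransportedBy.le/mul_mem` — and the two computations run on the target form);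
* hence Gross 1991 §3 / Darmon 2004 Thm. 3.6 for `τ = x(n)` and EVERY `n ≥ 1`:
  `phi_heegnerPointOfConductor_mem_range_map_ringClassField_of_ne_zero` — `y(n) = φ(x(n))` is the image
  of a point of `E(K[n])`, `K[n] = ringClassField K ι n` (the proof of
  `phi_heegnerPointOfConductor_mem_range_map_ringClassField_holds` verbatim, minus coprimality; for
  `gcd(n, N) > 1` the order of `x(n)` is still `𝒪_n`, the order of `Nx(n)` has conductor dividing `n`,
  so Darmon's `H` is `K[n]`, as printed in the special case `n = q ∥ N` by the named fact below);
* **`phi_heegnerPointOfConductor_mem_range_map_ringClassField_of_prime_dvd_level_holds`** — the named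
  fact of `HeegnerPointsOfConductorPrimeLevel.lean` (Darmon Thm. 3.6 at `τ = x(q)`, `q ∥ N`; the binder
  `hD` / `hRM.1` of the (M)-road files `SchneiderFreeAdditiveX3PotMult*` / `…UpperWing*` /
  `…DoorResidue`) is now a THEOREM (its hypotheses `q.Prime`, `ord_q N = 1` and the Heegner hypothesis
  are not even needed).

HONEST FRAMING: classical CM theory (Shimura reciprocity on `X₀(N)`), proved on top of the tree's
transport files; no statement about `L`-functions or BSD. For the (M) road of route
`SchneiderFreeAdditiveX3` one carried hypothesis becomes a theorem; nothing else changes. Found by the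
ARM-P cited-input audit (cell `pub/bsd-cited`, seat r10, base-role discharge).

## References

* [Darmon2004] H. Darmon, *Rational points on modular elliptic curves*, CBMS 101 (2004), Thm. 3.6
  with Thm. 3.5 (PDF pp. 42–44), Thm. 3.7.
* [GrossLMS1991] B. H. Gross, *Kolyvagin's work on modular elliptic curves*, LMS LN 153 (1991), §3
  (p. 238).
* [Gross1984] B. H. Gross, *Heegner points on `X₀(N)`* (1984), §I.1 (the `𝔫`-relations).
* [Cox2013] D. A. Cox, *Primes of the form x² + ny²*, 2nd ed., Thm. 10.9, Thm. 11.1.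

## Mathlib / tree search

Tree, by name: `inv_mul_theta_mul_mem_lattice`, `thetaBar_mul_mem_lattice_levelPoint`,
`lattice_levelPoint_le`, `natCast_mul_mem_lattice_levelPoint`, `levelTransport_of_isTransportedBy`,
`exists_isTransportedBy`, `IsTransportedBy.le/mul_mem/mulLeft/j_eq`, `exists_lattice_eq_mulLeft_of_j_eq`,
`sqrtDisc_eq`, `heegnerTau_isRoot`, `ringEquiv_apply_theta/thetaBar`, `heegnerFormOfConductor_mem_heegnerForms`,
`kleinJ_heegnerPointOfConductor_mem_ringClassField`, `apply_sqrtDisc_discr_eq`, `apply_mem_ringClassField`,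
`finiteDimensional_and_isGalois_ringClassField`, `ModularParametrizationData.isAutEquivariantOnHeegner`,
`Complex.mem_subfield_of_forall_ringEquiv`; Mathlib `PeriodPair.mem_lattice`, `Int.gcd_eq_gcd_ab`.
`rg '_of_prime_dvd_level_holds'` over `lean/`: no prior discharge.
-/

noncomputable section

open scoped Cardinal

universe u

namespace Literature.NumberTheory.EllipticCurves

open Complex UpperHalfPlane PeriodPair Cardinal
open Literature.NumberTheory.EllipticCurves.ModularForms
open Literature.NumberTheory.QuadraticFields.BinaryQuadraticForm
open Literature.FieldTheory.AlgClosed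

/-! ### §1 Arithmetic of a Heegner form: `gcd(N, B, C) = 1` -/

section Arithmetic

variable {N : ℕ} {D : ℤ} {Q : ℤ × ℤ × ℤ}

/-- A natural number whose integer cast is a unit is `1`. [folklore] -/
private theorem natCast_eq_one_of_isUnit {e : ℕ} (h : IsUnit (e : ℤ)) : (e : ℤ) = 1 := by
  rcases Int.isUnit_iff.mp h with h1 | h1
  · exact h1
  · exfalso; have : (0 : ℤ) ≤ e := Int.natCast_nonneg e; omega

/-- **`gcd(N, B, C) = 1` for a Heegner form of level `N`** (`N ∣ A` and `gcd(A, B, C) = 1`), in the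
form: `N ∣ mB` and `N ∣ mC` imply `N ∣ m`. [cite: Gross1984, §I.1 (Heegner forms (A, B, C), N ∣ A, primitive)] -/
theorem natCast_dvd_of_dvd_mul_of_mem_heegnerForms (hQ : Q ∈ heegnerForms N D) {m : ℤ}
    (hB : (N : ℤ) ∣ m * Q.2.1) (hC : (N : ℤ) ∣ m * Q.2.2) : (N : ℤ) ∣ m := by
  obtain ⟨-, -, hNA, hprim⟩ := hQ
  set g : ℕ := Int.gcd Q.2.1 Q.2.2 with hg
  have hmg : (N : ℤ) ∣ m * g := by
    rw [hg, Int.gcd_eq_gcd_ab Q.2.1 Q.2.2, mul_add, ← mul_assoc, ← mul_assoc]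
    exact dvd_add (dvd_mul_of_dvd_left hB _) (dvd_mul_of_dvd_left hC _)
  have hcop : IsCoprime (N : ℤ) (g : ℤ) := by
    rw [Int.isCoprime_iff_gcd_eq_one]
    set e : ℕ := Int.gcd (N : ℤ) (g : ℤ) with he
    have heN : (e : ℤ) ∣ (N : ℤ) := Int.gcd_dvd_left ..
    have heg : (e : ℤ) ∣ (g : ℤ) := Int.gcd_dvd_right ..
    have hu : IsUnit (e : ℤ) := hprim e (heN.trans hNA)
      (heg.trans (hg ▸ Int.gcd_dvd_left ..)) (heg.trans (hg ▸ Int.gcd_dvd_right ..))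
    exact_mod_cast natCast_eq_one_of_isUnit hu
  exact hcop.dvd_of_dvd_mul_right hmg

/-- **Three-term Bezout for a Heegner form**: if `N ∣ B − β'` then `pN + qβ' + rC = 1` for some
integers (any common divisor of `N, β', C` divides `A, B, C`). [cite: Gross1984, §I.1 (Heegner forms (A, B, C), N ∣ A, primitive)] -/
theorem exists_combination_eq_one_of_mem_heegnerForms (hQ : Q ∈ heegnerForms N D) {β' : ℤ}
    (hβ : (N : ℤ) ∣ Q.2.1 - β') : ∃ p q r : ℤ, p * N + q * β' + r * Q.2.2 = 1 := by
  obtain ⟨-, -, hNA, hprim⟩ := hQ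
  set g : ℕ := Int.gcd β' Q.2.2 with hg
  set e : ℕ := Int.gcd (N : ℤ) (g : ℤ) with he
  have heN : (e : ℤ) ∣ (N : ℤ) := Int.gcd_dvd_left ..
  have heg : (e : ℤ) ∣ (g : ℤ) := Int.gcd_dvd_right ..
  have heβ : (e : ℤ) ∣ β' := heg.trans (hg ▸ Int.gcd_dvd_left ..)
  have heC : (e : ℤ) ∣ Q.2.2 := heg.trans (hg ▸ Int.gcd_dvd_right ..)
  have heB : (e : ℤ) ∣ Q.2.1 := by
    have : Q.2.1 = (Q.2.1 - β') + β' := by ring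
    rw [this]; exact dvd_add (heN.trans hβ) heβ
  have he1 : (e : ℤ) = 1 := natCast_eq_one_of_isUnit (hprim e (heN.trans hNA) heB heC)
  refine ⟨Int.gcdA (N : ℤ) (g : ℤ), Int.gcdB (N : ℤ) (g : ℤ) * Int.gcdA β' Q.2.2,
    Int.gcdB (N : ℤ) (g : ℤ) * Int.gcdB β' Q.2.2, ?_⟩
  have h1 : ((e : ℕ) : ℤ) = N * Int.gcdA (N : ℤ) (g : ℤ) + g * Int.gcdB (N : ℤ) (g : ℤ) :=
    Int.gcd_eq_gcd_ab ..
  have h2 : ((g : ℕ) : ℤ) = β' * Int.gcdA β' Q.2.2 + Q.2.2 * Int.gcdB β' Q.2.2 := Int.gcd_eq_gcd_ab ..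
  rw [he1] at h1
  linear_combination -h1 - Int.gcdB (N : ℤ) (g : ℤ) * h2

end Arithmetic

/-! ### §2 Two explicit lattice computations for a Heegner form -/

section Relations

variable {N : ℕ} [NeZero N] {D β : ℤ} {Q : ℤ × ℤ × ℤ}

/-- Coefficients in the basis `(τ, 1)` are unique (`Im τ > 0`). [folklore] -/
private theorem intCast_coeff_eq {τ : ℍ} {a b a' b' : ℤ}
    (h : (a : ℂ) * (τ : ℂ) + b = (a' : ℂ) * τ + b') : a = a' ∧ b = b' := by
  have him := congrArg Complex.im h
  simp only [add_im, mul_im, intCast_re, intCast_im, zero_mul, add_zero, UpperHalfPlane.coe_im]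
    at him
  have ha : (a : ℝ) = a' := mul_right_cancel₀ τ.im_pos.ne' him
  have ha' : a = a' := by exact_mod_cast ha
  subst ha'
  have hb : (b : ℂ) = b' := add_left_cancel h
  exact ⟨rfl, by exact_mod_cast hb⟩

/-- **Upper bound.** For a Heegner form `Q` of level `N`, discriminant `D < 0`, `B ≡ β (mod 2N)`,
`θ = (−β + √D)/2`: if `y ∈ Λ_τ` and `θy ∈ NΛ_τ` then `y ∈ Λ_{Nτ} = ℤNτ + ℤ` — writing `y = mτ + n`,
`θy ≡ −m(Bτ + C) (mod NΛ_τ)`, and `N ∣ mB, mC` forces `N ∣ m` (`gcd(N, B, C) = 1`). [cite: Gross1984, §I.1] -/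
theorem mem_lattice_levelPoint_of_inv_theta_mul_mem (hQ : Q ∈ heegnerForms N D) (hD : D < 0)
    (hβ : Q.2.1 ≡ β [ZMOD 2 * N]) {y : ℂ} (hy : y ∈ (ofUpperHalfPlane (heegnerTau Q)).lattice)
    (hθy : (N : ℂ)⁻¹ * ((-β + sqrtDisc D) / 2 * y) ∈ (ofUpperHalfPlane (heegnerTau Q)).lattice) :
    y ∈ (ofUpperHalfPlane (levelPoint N (heegnerTau Q))).lattice := by
  have hQ0 := hQ
  obtain ⟨hdisc, hA, hNA, -⟩ := hQ
  obtain ⟨A', hA'⟩ := hNA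
  obtain ⟨k, hk⟩ := (Int.modEq_iff_dvd.mp hβ.symm)
  have hneg : Q.2.1 ^ 2 - 4 * Q.1 * Q.2.2 < 0 := hdisc ▸ hD
  have hroot := heegnerTau_isRoot hA hneg
  have hs := sqrtDisc_eq hA hdisc hD
  have hN0 : (N : ℂ) ≠ 0 := by exact_mod_cast NeZero.ne N
  have hAC : (Q.1 : ℂ) = N * A' := by exact_mod_cast hA'
  have hkC : (Q.2.1 : ℂ) - β = 2 * N * k := by exact_mod_cast hk
  have hroot' : (N : ℂ) * A' * (heegnerTau Q : ℂ) ^ 2 + Q.2.1 * heegnerTau Q + Q.2.2 = 0 := by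
    rw [← hAC]; exact hroot
  have hθ : (-(β : ℂ) + sqrtDisc D) / 2 = N * (A' * heegnerTau Q + k) := by
    rw [hs, hAC]; linear_combination (1 / 2 : ℂ) * hkC
  obtain ⟨m, n, rfl⟩ := mem_lattice.mp hy
  obtain ⟨m', n', hmn⟩ := mem_lattice.mp hθy
  simp only [ofUpperHalfPlane_ω₁, ofUpperHalfPlane_ω₂, mul_one] at hmn ⊢
  -- `N⁻¹θ(mτ + n) = (m(Nk − B)/N + nA')τ + (nk − mC/N)`; compare coefficients after clearing `N`
  have key : ((N * m' : ℤ) : ℂ) * (heegnerTau Q : ℂ) + ((N * n' : ℤ) : ℂ) =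
      ((m * (N * k - Q.2.1) + n * N * A' : ℤ) : ℂ) * heegnerTau Q + ((n * N * k - m * Q.2.2 : ℤ) : ℂ) := by
    have h1 : (N : ℂ) * ((m' : ℂ) * heegnerTau Q + n') = (-(β : ℂ) + sqrtDisc D) / 2 * (m * heegnerTau Q + n) := by
      rw [hmn, ← mul_assoc, mul_inv_cancel₀ hN0, one_mul]
    rw [hθ] at h1
    push_cast
    linear_combination h1 + (m : ℂ) * hroot'
  obtain ⟨h1, h2⟩ := intCast_coeff_eq key
  have hB : (N : ℤ) ∣ m * Q.2.1 := ⟨m * k + n * A' - m', by linear_combination h1⟩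
  have hC : (N : ℤ) ∣ m * Q.2.2 := ⟨n * k - n', by linear_combination h2⟩
  obtain ⟨m₀, rfl⟩ := natCast_dvd_of_dvd_mul_of_mem_heegnerForms hQ0 hB hC
  refine mem_lattice.mpr ⟨m₀, n, ?_⟩
  simp only [ofUpperHalfPlane_ω₁, ofUpperHalfPlane_ω₂, coe_levelPoint, mul_one]
  push_cast
  ring

/-- **Lower bound: `Λ_{Nτ} ⊆ NΛ_τ + θ'Λ_τ`** for a Heegner form of level `N`, discriminant `D < 0`,
`B ≡ β (mod 2N)` (`B − β = 2Nk`), `θ' = (−β − √D)/2`: `Nτ ∈ NΛ_τ`, and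
`1 = pN + q(Nk + β) + rC` with `Nk + β = −θ'·1 − NA'τ`, `C = θ'τ − Nkτ`. [cite: Gross1984, §I.1] -/
theorem exists_eq_add_of_mem_lattice_levelPoint (hQ : Q ∈ heegnerForms N D) (hD : D < 0)
    (hβ : Q.2.1 ≡ β [ZMOD 2 * N]) {x : ℂ}
    (hx : x ∈ (ofUpperHalfPlane (levelPoint N (heegnerTau Q))).lattice) :
    ∃ a ∈ (ofUpperHalfPlane (heegnerTau Q)).lattice, ∃ b ∈ (ofUpperHalfPlane (heegnerTau Q)).lattice,
      x = N * a + (-β - sqrtDisc D) / 2 * b := by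
  have hQ0 := hQ
  obtain ⟨hdisc, hA, hNA, -⟩ := hQ
  obtain ⟨A', hA'⟩ := hNA
  obtain ⟨k, hk⟩ := (Int.modEq_iff_dvd.mp hβ.symm)
  have hneg : Q.2.1 ^ 2 - 4 * Q.1 * Q.2.2 < 0 := hdisc ▸ hD
  have hroot := heegnerTau_isRoot hA hneg
  have hs := sqrtDisc_eq hA hdisc hD
  have hAC : (Q.1 : ℂ) = N * A' := by exact_mod_cast hA'
  have hkC : (Q.2.1 : ℂ) - β = 2 * N * k := by exact_mod_cast hk
  have hroot' : (N : ℂ) * A' * (heegnerTau Q : ℂ) ^ 2 + Q.2.1 * heegnerTau Q + Q.2.2 = 0 := by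
    rw [← hAC]; exact hroot
  have hθ' : (-(β : ℂ) - sqrtDisc D) / 2 = -((N : ℂ) * (A' * heegnerTau Q + k)) - β := by
    rw [hs, hAC]; linear_combination (-1 / 2 : ℂ) * hkC
  -- three-term Bezout `pN + q(Nk + β) + rC = 1`
  have hNdvd : (N : ℤ) ∣ Q.2.1 - (N * k + β) := ⟨k, by linear_combination hk⟩
  obtain ⟨p, q, r, hpqr⟩ := exists_combination_eq_one_of_mem_heegnerForms hQ0 hNdvd
  have hpqrC : (p : ℂ) * N + q * (N * k + β) + r * Q.2.2 = 1 := by exact_mod_cast hpqr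
  obtain ⟨m, n, rfl⟩ := mem_lattice.mp hx
  refine ⟨(m - n * q * A' - n * r * k : ℤ) * (heegnerTau Q : ℂ) + (n * p : ℤ),
    mem_lattice.mpr ⟨m - n * q * A' - n * r * k, n * p, by
      simp only [ofUpperHalfPlane_ω₁, ofUpperHalfPlane_ω₂, mul_one]⟩,
    (n * r : ℤ) * (heegnerTau Q : ℂ) + (-(n * q) : ℤ),
    mem_lattice.mpr ⟨n * r, -(n * q), by simp only [ofUpperHalfPlane_ω₁, ofUpperHalfPlane_ω₂, mul_one]⟩, ?_⟩
  simp only [ofUpperHalfPlane_ω₁, ofUpperHalfPlane_ω₂, coe_levelPoint, mul_one]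
  rw [hθ']
  push_cast
  linear_combination (n * r : ℂ) * hroot' - (n * r : ℂ) * (heegnerTau Q : ℂ) * hkC - (n : ℂ) * hpqrC

end Relations

/-! ### §3 The engine without `gcd(N, D) = 1` -/

section Engine

variable {N : ℕ} [NeZero N] {D β : ℤ} {σ : ℂ ≃+* ℂ} {Q Q' : ℤ × ℤ × ℤ}

/-- **The engine, primitive form** (no `gcd(N, D) = 1`). Let `Q, Q'` be Heegner forms of level `N`,
discriminant `D < 0`, with `B ≡ B' ≡ β (mod 2N)`, and `σ ∈ Aut(ℂ)` fixing `√D`. If the transport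
`Λ_{τ_Q}^σ` is `cΛ_{τ_{Q'}}`, then `LevelTransport N σ τ_Q τ_{Q'}`: the transport `M_N` of `Λ_{Nτ_Q}`
satisfies `NM ⊆ M_N ⊆ M`, `θM_N ⊆ NM`, `θ'M ⊆ M_N` (`IsTransportedBy.le/mul_mem`), and on
`M = cΛ_{τ_{Q'}}` these force `M_N = cΛ_{Nτ_{Q'}}` by the two computations of §2 for `Q'`.
(Gross 1984, §I.1; Darmon 2004, Thm. 3.7.) [cite: Gross1984, §I.1] [cite: Darmon2004, Thm. 3.7] -/
theorem levelTransport_of_transport_lattice_eq_of_primitive (hD : D < 0)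
    (hσ : σ (sqrtDisc D) = sqrtDisc D) (hQ : Q ∈ heegnerForms N D) (hβ : Q.2.1 ≡ β [ZMOD 2 * N])
    (hQ' : Q' ∈ heegnerForms N D) (hβ' : Q'.2.1 ≡ β [ZMOD 2 * N])
    {M : PeriodPair} (hM : IsTransportedBy σ (ofUpperHalfPlane (heegnerTau Q)) M)
    {c : ℂ} (hc : c ≠ 0) (hMc : M.lattice = ((ofUpperHalfPlane (heegnerTau Q')).mulLeft c hc).lattice) :
    LevelTransport N σ (heegnerTau Q) (heegnerTau Q') := by
  have hN0 : (N : ℂ) ≠ 0 := by exact_mod_cast NeZero.ne N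
  obtain ⟨M_N, hMN⟩ := exists_isTransportedBy σ (ofUpperHalfPlane (levelPoint N (heegnerTau Q)))
  -- the four transported `𝔫`-relations
  have h1 : M_N.lattice ≤ M.lattice := hMN.le hM (lattice_levelPoint_le _)
  have h2 : ∀ a ∈ M.lattice, (N : ℂ) * a ∈ M_N.lattice := by
    have h := hM.mul_mem hMN (natCast_mul_mem_lattice_levelPoint (N := N) (heegnerTau Q))
    rwa [map_natCast] at h
  have h3 : ∀ z ∈ M_N.lattice, (N : ℂ)⁻¹ * ((-β + sqrtDisc D) / 2 * z) ∈ M.lattice := by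
    have h3₀ : ∀ l ∈ (ofUpperHalfPlane (levelPoint N (heegnerTau Q))).lattice,
        (-β + sqrtDisc D) / 2 * l ∈ ((ofUpperHalfPlane (heegnerTau Q)).mulLeft N hN0).lattice :=
      fun l hl ↦ mem_mulLeft_lattice.mpr (inv_mul_theta_mul_mem_lattice hQ hD hβ l hl)
    have h := hMN.mul_mem (hM.mulLeft N hN0) h3₀
    intro z hz
    have hz' := h z hz
    rw [ringEquiv_apply_theta hσ, mem_mulLeft_lattice, map_natCast] at hz'
    exact hz'
  have h4 : ∀ b ∈ M.lattice, (-β - sqrtDisc D) / 2 * b ∈ M_N.lattice := by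
    have h := hM.mul_mem hMN (thetaBar_mul_mem_lattice_levelPoint hQ hD hβ)
    rwa [ringEquiv_apply_thetaBar hσ] at h
  refine levelTransport_of_isTransportedBy hM hMN hc hMc (le_antisymm ?_ ?_)
  · -- `M_N ⊆ cΛ'_N`: upper bound on `Q'`
    intro x hx
    rw [mem_mulLeft_lattice]
    have hxM : c⁻¹ * x ∈ (ofUpperHalfPlane (heegnerTau Q')).lattice := by
      rw [← mem_mulLeft_lattice (hc := hc), ← hMc]; exact h1 hx
    have hθx : (N : ℂ)⁻¹ * ((-β + sqrtDisc D) / 2 * (c⁻¹ * x)) ∈ (ofUpperHalfPlane (heegnerTau Q')).lattice := by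
      have h := h3 x hx
      rw [hMc, mem_mulLeft_lattice] at h
      have : c⁻¹ * ((N : ℂ)⁻¹ * ((-β + sqrtDisc D) / 2 * x)) =
          (N : ℂ)⁻¹ * ((-β + sqrtDisc D) / 2 * (c⁻¹ * x)) := by ring
      rwa [this] at h
    exact mem_lattice_levelPoint_of_inv_theta_mul_mem hQ' hD hβ' hxM hθx
  · -- `cΛ'_N ⊆ M_N`: lower bound on `Q'`
    intro x hx
    rw [mem_mulLeft_lattice] at hx
    obtain ⟨a, ha, b, hb, hab⟩ := exists_eq_add_of_mem_lattice_levelPoint hQ' hD hβ' hx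
    have hx' : x = N * (c * a) + (-β - sqrtDisc D) / 2 * (c * b) := by
      have : x = c * (c⁻¹ * x) := by rw [← mul_assoc, mul_inv_cancel₀ hc, one_mul]
      rw [this, hab]; ring
    rw [hx']
    refine add_mem (h2 _ ?_) (h4 _ ?_)
    · rw [hMc, mem_mulLeft_lattice, ← mul_assoc, inv_mul_cancel₀ hc, one_mul]; exact ha
    · rw [hMc, mem_mulLeft_lattice, ← mul_assoc, inv_mul_cancel₀ hc, one_mul]; exact hb

/-- **`Aut(ℂ/K(√D, j(τ_Q)))` fixes the Heegner point `τ_Q` of `X₀(N)`, primitive form** (no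
`gcd(N, D) = 1`): if `σ` fixes `√D` and `j(τ_Q)`, then `LevelTransport N σ τ_Q τ_Q` (`Λ^σ` is
homothetic to `Λ` by Cox Thm. 10.9, and the engine applies with `Q' = Q`). Darmon 2004, proof of
Thm. 3.6: "`(j(τ), j(Nτ)) ∈ X₀(N)(H)`". [cite: Darmon2004, Thm. 3.6 (PDF p. 43)] [cite: Cox2013, Thm. 10.9] -/
theorem levelTransport_self_of_apply_formJ_eq_of_primitive (hD : D < 0)
    (hσ : σ (sqrtDisc D) = sqrtDisc D) (hQ : Q ∈ heegnerForms N D) (hβ : Q.2.1 ≡ β [ZMOD 2 * N])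
    (hj : σ (formJ Q) = formJ Q) : LevelTransport N σ (heegnerTau Q) (heegnerTau Q) := by
  obtain ⟨M, hM⟩ := exists_isTransportedBy σ (ofUpperHalfPlane (heegnerTau Q))
  have hjM : (ofUpperHalfPlane (heegnerTau Q)).j = M.j := by
    rw [hM.j_eq, ← formJ_def, hj, formJ_def]
  obtain ⟨c, hc, hMc⟩ := exists_lattice_eq_mulLeft_of_j_eq hjM
  exact levelTransport_of_transport_lattice_eq_of_primitive hD hσ hQ hβ hQ hβ hM hc hMc

end Engine

/-! ### §4 `y(n) = φ(x(n)) ∈ E(K[n])` for every `n ≥ 1` -/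

/-- `√(m²D) = m√D`. [folklore] -/
private theorem sqrtDisc_conductor_sq_mul' (D : ℤ) (m : ℕ) :
    sqrtDisc ((m : ℤ) ^ 2 * D) = (m : ℂ) * sqrtDisc D := by
  unfold sqrtDisc
  have hm : (0 : ℝ) ≤ m := Nat.cast_nonneg m
  have h : -(((m : ℤ) ^ 2 * D : ℤ) : ℝ) = (m : ℝ) ^ 2 * (-(D : ℝ)) := by push_cast; ring
  rw [h, Real.sqrt_mul (sq_nonneg _), Real.sqrt_sq hm]
  push_cast
  ring

section Transport

variable {K : Type u} [Field K] [NumberField K]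

/-- **Every `σ ∈ Aut(ℂ/K[m])` fixes the Heegner point `x(m)` of `Y₀(N)`**, for `K` imaginary
quadratic, `4N ∣ β² − d_K` and ANY `m ≠ 0` (no `gcd(m, N) = 1`): `σ` fixes `√(m²d_K)` and
`j(x(m)) ∈ K[m]`, and the primitive engine applies to the Heegner form of conductor `m`.
[cite: GrossLMS1991, §3 (x_n rational over K_n)] [cite: Darmon2004, Thm. 3.6 (PDF p. 43)] -/
theorem levelTransport_heegnerPointOfConductor_self_of_fix_ringClassField (hK : IsImaginaryQuadratic K)
    (ι : K →+* ℂ) {N : ℕ} [NeZero N] {β : ℤ} (hβ : (4 * N : ℤ) ∣ β ^ 2 - NumberField.discr K)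
    {m : ℕ} (hm : m ≠ 0) {σ : ℂ ≃+* ℂ} (hσ : ∀ x ∈ ringClassField K ι m, σ x = x) :
    LevelTransport N σ (heegnerPointOfConductor (NumberField.discr K) β m)
      (heegnerPointOfConductor (NumberField.discr K) β m) := by
  set D : ℤ := NumberField.discr K with hDdef
  have hm0 : (0 : ℤ) < m := by exact_mod_cast Nat.pos_of_ne_zero hm
  have hDm : (m : ℤ) ^ 2 * D < 0 := mul_neg_of_pos_of_neg (pow_pos hm0 2) hK.discr_neg
  obtain ⟨hQ, hQβ⟩ := heegnerFormOfConductor_mem_heegnerForms (N := N) hK.discr_neg hβ hm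
  have hσK : ∀ k : K, σ (ι k) = ι k := fun k => hσ _ (apply_mem_ringClassField ι m k)
  have hsqrt : σ (sqrtDisc ((m : ℤ) ^ 2 * D)) = sqrtDisc ((m : ℤ) ^ 2 * D) := by
    rw [sqrtDisc_conductor_sq_mul', map_mul, map_natCast, apply_sqrtDisc_discr_eq hK ι hσK]
  have hj : σ (formJ (heegnerFormOfConductor D β m)) = formJ (heegnerFormOfConductor D β m) := by
    rw [formJ_eq_kleinJ]
    exact hσ _ (kleinJ_heegnerPointOfConductor_mem_ringClassField hK ι hβ hm)
  exact levelTransport_self_of_apply_formJ_eq_of_primitive hDm hsqrt hQ hQβ hj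

/-- `K[n]` is countable (`K[n]/K` finite). [folklore] -/
private theorem cardinalMk_ringClassField_le' (hK : IsImaginaryQuadratic K) (ι : K →+* ℂ) {n : ℕ}
    (hn : n ≠ 0) : #(ringClassField K ι n) ≤ ℵ₀ := by
  haveI := (finiteDimensional_and_isGalois_ringClassField hK ι hn).1
  haveI : FiniteDimensional ℚ (ringClassField K ι n) := Module.Finite.trans K (ringClassField K ι n)
  haveI : Algebra.IsAlgebraic ℚ (ringClassField K ι n) := Algebra.IsAlgebraic.of_finite ℚ _
  exact Subfield.cardinalMk_le_aleph0_of_isAlgebraic _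

end Transport

variable (N : ℕ) [NeZero N] (W : WeierstrassCurve ℚ) (K : Type u) [Field K] [NumberField K]

/-- **Gross 1991 §3 / Darmon Thm. 3.6 at conductor `n`, for EVERY `n ≥ 1`, PROVED**: for `E/ℚ`
elliptic with model `W`, `K` imaginary quadratic, every modular parametrisation datum `Dt` at level
`N`, every orientation `β` (`4N ∣ β² − d_K`), every embedding `ι : K → ℂ` and every `n ≠ 0`
(coprime to `N` OR NOT), the complex point `y(n) = φ(x(n))` is the image under `K[n] ⊂ ℂ` of a point of
`E(K[n])`. (Darmon Thm. 3.6 for `τ = x(n)`: the order of `τ` is `𝒪_n`, that of `Nτ` has conductor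
dividing `n`, so `H = K[n]`.) [cite: Darmon2004, Thm. 3.6 (PDF pp. 43–44)] [cite: GrossLMS1991, §3 (p. 238)] -/
theorem phi_heegnerPointOfConductor_mem_range_map_ringClassField_of_ne_zero [W.IsElliptic]
    (hK : IsImaginaryQuadratic K) (Dt : ModularParametrizationData W N) (β : ℤ) (ι : K →+* ℂ)
    (n : ℕ) (hβ : (4 * N : ℤ) ∣ β ^ 2 - NumberField.discr K) (hn : n ≠ 0) :
    ∃ P : (W.baseChange (ringClassField K ι n)).toAffine.Point,
      WeierstrassCurve.Affine.Point.map (ringClassField K ι n).subtype.toRatAlgHom P =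
        heegnerPointComplexOfConductor Dt (NumberField.discr K) β n := by
  set F := ringClassField K ι n with hF_def
  have hn0 : (0 : ℤ) < n := by exact_mod_cast Nat.pos_of_ne_zero hn
  have hDn : (n : ℤ) ^ 2 * NumberField.discr K < 0 := mul_neg_of_pos_of_neg (pow_pos hn0 2) hK.discr_neg
  obtain ⟨hQ, -⟩ := heegnerFormOfConductor_mem_heegnerForms (N := N) hK.discr_neg hβ hn
  have hφ : Dt.IsAutEquivariantOnHeegner ((n : ℤ) ^ 2 * NumberField.discr K) :=
    Dt.isAutEquivariantOnHeegner _
  have hfix : ∀ σ : ℂ ≃+* ℂ, (∀ x ∈ F, σ x = x) →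
      WeierstrassCurve.Affine.Point.map (σ : ℂ →+* ℂ).toRatAlgHom
          (heegnerPointComplexOfConductor Dt (NumberField.discr K) β n) =
        heegnerPointComplexOfConductor Dt (NumberField.discr K) β n := by
    intro σ hσ
    have hσK : ∀ k : K, σ (ι k) = ι k := fun k => hσ _ (apply_mem_ringClassField ι n k)
    have hsqrt : σ (sqrtDisc ((n : ℤ) ^ 2 * NumberField.discr K)) =
        sqrtDisc ((n : ℤ) ^ 2 * NumberField.discr K) := by
      rw [sqrtDisc_conductor_sq_mul', map_mul, map_natCast, apply_sqrtDisc_discr_eq hK ι hσK]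
    exact hφ σ hsqrt hQ hQ
      (levelTransport_heegnerPointOfConductor_self_of_fix_ringClassField hK ι hβ hn hσ)
  have hFc : #F ≤ ℵ₀ := cardinalMk_ringClassField_le' hK ι hn
  rcases hP₀ : heegnerPointComplexOfConductor Dt (NumberField.discr K) β n with _ | ⟨x, y, hxy⟩
  · exact ⟨0, rfl⟩
  · have hcoord : ∀ σ : ℂ ≃+* ℂ, (∀ z ∈ F, σ z = z) → σ x = x ∧ σ y = y := by
      intro σ hσ
      have h := hfix σ hσ
      rw [hP₀, WeierstrassCurve.Affine.Point.map_some] at h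
      have h12 := WeierstrassCurve.Affine.Point.some.inj h
      exact ⟨h12.1, h12.2⟩
    have hx : x ∈ F := Complex.mem_subfield_of_forall_ringEquiv F hFc fun σ hσ ↦ (hcoord σ hσ).1
    have hy : y ∈ F := Complex.mem_subfield_of_forall_ringEquiv F hFc fun σ hσ ↦ (hcoord σ hσ).2
    have h₀ : (W.baseChange F).toAffine.Nonsingular ⟨x, hx⟩ ⟨y, hy⟩ :=
      (WeierstrassCurve.Affine.baseChange_nonsingular W (f := F.subtype.toRatAlgHom)
        F.subtype.injective ⟨x, hx⟩ ⟨y, hy⟩).mp hxy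
    exact ⟨.some ⟨x, hx⟩ ⟨y, hy⟩ h₀, rfl⟩

/-- **The named fact `phi_heegnerPointOfConductor_mem_range_map_ringClassField_of_prime_dvd_level`
HOLDS** (Darmon 2004 Thm. 3.6 at `τ = x(q)`, `q ∥ N`: `Φ_N(x(q)) ∈ E(K[q])`): the special case
`n = q` of `phi_heegnerPointOfConductor_mem_range_map_ringClassField_of_ne_zero` (the hypotheses
"`q` prime", "`ord_q N = 1`" and the Heegner hypothesis are not used). Discharges the binder `hD` /
`hRM.1` of the (M) road of route `SchneiderFreeAdditiveX3`.
[cite: Darmon2004, Thm. 3.6 with Thm. 3.5 (PDF pp. 42–44)] [cite: GrossLMS1991, §3 (pp. 238–239)] -/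
theorem phi_heegnerPointOfConductor_mem_range_map_ringClassField_of_prime_dvd_level_holds :
    phi_heegnerPointOfConductor_mem_range_map_ringClassField_of_prime_dvd_level := by
  intro N _ W _ K _ _ hK _ Dt β ι q hβ hq _
  exact phi_heegnerPointOfConductor_mem_range_map_ringClassField_of_ne_zero N W K hK Dt β ι q hβ
    hq.ne_zero

end Literature.NumberTheory.EllipticCurves

end
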